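import Summits.BirchSwinnertonDyer.Rank1Residual.P2.CMKolyvaginHabitatTamagawaMordell
import Summits.BirchSwinnertonDyer.Rank1Residual.P2.CMKolyvaginHabitatImageAtTwo
import Summits.BirchSwinnertonDyer.Rank1Residual.P2.CornerFTwoModelClasses
import Literature.NumberTheory.EllipticCurves.BoxerDiao2010.TamagawaTwistHolds
import Literature.NumberTheory.EllipticCurves.Rank1Residual.X11RankOneCertificates.Minimality
import HarnessLib

/-!
# Route `CMKolyvaginAtInertTwo` (leaf `WAllCornerFTwo`): the `j = −12288000` CLASS against the
# habitat `H₂` — the quadratic twists of `27a4`, every arithmetic binder decided by `d`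

Cell `bsd-print-cf2`, seat ty2 (discharge interface), line `route-BirchSwinnertonDyer-CMKolyvaginAtInertTwo`
(items stmt-BirchSwinnertonDyer-22835/22836, residual 22838). HONEST FRAMING: THEOREMS ONLY — no
definition, no named fact, no route file imported, nothing about BSD asserted or booked; the leaf is OPEN.

By the tree's `CornerFTwo.Atlas.inertAtlas`, a CM curve with `2` inert is a model of (a) `y² = x³ + k`
(`j = 0`; decided in `CMKolyvaginHabitatMordell`), (b) a twist of `(0,6,0,−3,0)` (`j = 54000`, rational
`2`-torsion: off `H₂` by the image binder), (c) a square-free twist `E^{(d)}` of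
`27a4 = (0,0,1,−30,63)` (`j = −12288000`), or (d)–(h) a twist of one of the five odd-inert CM bases.
This file decides the arithmetic binders of `H₂` on (c): for `d ∈ ℤ ∖ {0}` square-free and EVERY model
`W'` of `27a4^{(d)}` (`C • W' = 27a4.quadraticTwist d`):

* `hasCM_and_cmInert_two_twist` — CM (order of conductor `3` in `ℚ(√−3)`), `2` inert: ALWAYS;
* `hasSurjectiveModNGaloisRep_two_twist` — `ρ̄₂` onto: ALWAYS (`E(ℚ)[2] = 0`, `j ≠ 54000`);
* `odd_tamagawaProduct_twist_iff` — **`Odd ∏ c_ℓ(W') ⟺ d` is SILENT: for every prime `p ≥ 5` dividing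
  `d`, the `2`-division cubic `4x³ − 120x + 253` of `27a4` has no root mod `p`** (Kriz–Li's
  `𝒩`-condition). Mechanism (Boxer–Diao 2010, proof of Prop. 4.1, run in the tree on the integer twist
  model `J = (0, 0, 0, −480d², 4048d³)`): `c₂ = 1` (`BoxerDiao2010.localTamagawaNumber_two_eq_one`,
  `4 ∤ d`); at `3` the twist is of type IV (`3 ∤ d`: Rizzo row `(2,3,5)`) or II* (`3 ∣ d`: row
  `(4,6,11)`), `c₃ ∈ {1, 3}`; at `p ≥ 5`, `p ∤ d`: good, `c_p = 1` (`Δ(27a4) = −3⁵`); at `p ≥ 5`,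
  `p ∣ d`: type `I₀*` with cubic `4d₁·h(x/4d₁)`, `c_p = 1` without a root of `h` mod `p`, `2 ∣ c_p`
  with one;
* `arithmeticHabitat_twist_iff` — the conjunction `CM ∧ inert ∧ ρ̄₂ onto ∧ Odd ∏c` ⟺ `d` silent.

Numerical cross-check (EVIDENCE, not used): kit j295793 (PARI: all square-free `|d| ≤ 2000`, 2429
twists: parity of `∏ c_ℓ` = silence of `d` in every case; `c₂ = 1`, `c₃ ∈ {1,3}` always; 575 odd).

References: G. Boxer–P. Diao, Proc. AMS 138 (2010) proof of Prop. 4.1 [BoxerDiao2010]; Silverman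
*ATAEC* IV.9.4, Table 4.1 [SilvermanATAEC1994]; Rizzo, Compositio 136 (2003) Table II [Rizzo2003];
Dokchitser–Dokchitser, Math. Z. (2012) Thm. (1) [DokchitserDokchitserMathZ2012]; Cremona's tables
(label 27a4) [Cremona2006].
-/

set_option autoImplicit false

noncomputable section

open scoped Classical NumberField

open WeierstrassCurve NumberField IsDedekindDomain IsDedekindDomain.HeightOneSpectrum Rat.HeightOneSpectrum
  Literature.NumberTheory.EllipticCurves Literature.NumberTheory.EllipticCurves.Rizzo
  Literature.NumberTheory.EllipticCurves.BoxerDiao2010 Literature.NumberTheory.EllipticCurves.Rank1Residual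
  Literature.NumberTheory.EllipticCurves.Rank1Residual.X11RankOneCertificates
  Summit.BirchSwinnertonDyer.Rank1Residual.P2.CubeSum

namespace Summit.BirchSwinnertonDyer.Rank1Residual.P2.TwentySevenA4

/-! ## §1 The base `27a4 = (0, 0, 1, −30, 63)` -/

/-- **`27a4 = (0,0,1,−30,63)` is a global minimal model** (`Δ = −3⁵`: no `q¹² ∣ Δ`).
[cite: Cremona2006, §2 (label 27a4)] [cite: SilvermanAEC2009, VII.1 Remark 1.1] -/
theorem isGloballyMinimal_curve27a4 : (⟨0, 0, 1, -30, 63⟩ : WeierstrassCurve ℚ).IsGloballyMinimal := by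
  have e : (⟨0, 0, 1, -30, 63⟩ : WeierstrassCurve ℚ) =
      ⟨((0 : ℤ) : ℚ), ((0 : ℤ) : ℚ), ((1 : ℤ) : ℚ), ((-30 : ℤ) : ℚ), ((63 : ℤ) : ℚ)⟩ := by
    ext <;> simp
  rw [e]
  refine isGloballyMinimal_of_int_criterion 0 0 1 (-30) 63 fun q hq hboth => ?_
  have hΔ : discOf [0, 0, 1, -30, 63] = -243 := by decide
  have h12 : (q : ℤ) ^ 12 ∣ 243 := by
    have h := hboth.1
    rw [hΔ] at h
    exact Int.dvd_neg.mp h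
  have h12' : q ^ 12 ∣ 243 := by exact_mod_cast h12
  have hle : q ^ 12 ≤ 243 := Nat.le_of_dvd (by norm_num) h12'
  have hpow : 2 ^ 12 ≤ q ^ 12 := Nat.pow_le_pow_left hq.two_le 12
  omega

/-- The integer minimal model of `27a4` is `(0,0,1,−30,63)` itself. [cite: Cremona2006, §2 (label 27a4)] -/
theorem integralModelInt_curve27a4 :
    (haveI := isGloballyMinimal_curve27a4
     integralModelInt (⟨0, 0, 1, -30, 63⟩ : WeierstrassCurve ℚ)) = ⟨0, 0, 1, -30, 63⟩ := by
  haveI := isGloballyMinimal_curve27a4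
  apply WeierstrassCurve.map_injective (f := Int.castRingHom ℚ) Int.cast_injective
  dsimp only
  rw [map_integralModelInt]
  ext <;> simp [WeierstrassCurve.map]

/-- `c₄(27a4) = 1440 = 2⁵·3²·5`. [cite: Cremona2006, §2 (label 27a4)] -/
theorem c₄_curve27a4 : (⟨0, 0, 1, -30, 63⟩ : WeierstrassCurve ℚ).c₄ = 1440 := by
  norm_num [WeierstrassCurve.c₄, WeierstrassCurve.b₂, WeierstrassCurve.b₄]

/-- `c₆(27a4) = −54648 = −2³·3³·11·23`. [cite: Cremona2006, §2 (label 27a4)] -/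
theorem c₆_curve27a4 : (⟨0, 0, 1, -30, 63⟩ : WeierstrassCurve ℚ).c₆ = -54648 := by
  norm_num [WeierstrassCurve.c₆, WeierstrassCurve.b₂, WeierstrassCurve.b₄, WeierstrassCurve.b₆]

/-- `Δ(27a4) = −243 = −3⁵`. [cite: Cremona2006, §2 (label 27a4)] -/
theorem Δ_curve27a4 : (⟨0, 0, 1, -30, 63⟩ : WeierstrassCurve ℚ).Δ = -243 := by
  norm_num [WeierstrassCurve.Δ, WeierstrassCurve.b₂, WeierstrassCurve.b₄, WeierstrassCurve.b₆,
    WeierstrassCurve.b₈]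

/-- `Δ` of the integer model: `−243`. [cite: Cremona2006, §2 (label 27a4)] -/
theorem Δ_curve27a4_int : (⟨0, 0, 1, -30, 63⟩ : WeierstrassCurve ℤ).Δ = -243 := by
  norm_num [WeierstrassCurve.Δ, WeierstrassCurve.b₂, WeierstrassCurve.b₄, WeierstrassCurve.b₆,
    WeierstrassCurve.b₈]

/-! ## §2 The place over `3`: every twist is of type IV (`3 ∤ d`) or II* (`3 ∣ d`); `c₃` is odd -/

section Three

variable (W' : WeierstrassCurve ℚ) [W'.IsElliptic] {C : VariableChange ℚ} {d : ℤ}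
  (v : HeightOneSpectrum (𝓞 ℚ))

/-- `val3 (3ⁿ·z) = n` in the table's `WithTop ℤ` (`CubeSum.padicValRat_three_pow_mul_intCast`). [cite: Rizzo2003, §1.1 (p. 3)] -/
theorem val3_pow_mul_intCast {z : ℤ} (hz0 : z ≠ 0) (hz : ¬ (3 : ℤ) ∣ z) (n : ℕ) :
    val3 ((3 : ℚ) ^ n * (z : ℚ)) = ((n : ℤ) : WithTop ℤ) := by
  rw [val3, if_neg (mul_ne_zero (pow_ne_zero _ (by norm_num)) (Int.cast_ne_zero.mpr hz0)),
    padicValRat_three_pow_mul_intCast hz0 hz]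

/-- **Table II on `27a4^{(d)}`, `3 ∤ d`: valuations `(2, 3, 5)`, row `(2,3,5)`: Kodaira `IV`.**
(`c₄ = 3²·160d²`, `c₆ = 3³·(−2024d³)`, `Δ = 3⁵·(−d⁶)`.) [cite: Rizzo2003, Table II (p. 4), row (2,3,5)]
[cite: Papadopoulos1993, Table III (p = 3)] -/
theorem tableKodairaSymbolThree_twist_of_not_dvd (hd0 : d ≠ 0) (hd3 : ¬ (3 : ℤ) ∣ d) :
    ((⟨0, 0, 1, -30, 63⟩ : WeierstrassCurve ℚ).quadraticTwist (d : ℚ)).tableKodairaSymbolThree =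
      .IV := by
  have p3 : Prime (3 : ℤ) := Int.prime_three
  have hz4 : ¬ (3 : ℤ) ∣ 160 * d ^ 2 := fun h => by
    rcases p3.dvd_or_dvd h with h | h
    · norm_num at h
    · exact hd3 (p3.dvd_of_dvd_pow h)
  have hz6 : ¬ (3 : ℤ) ∣ -2024 * d ^ 3 := fun h => by
    rcases p3.dvd_or_dvd h with h | h
    · norm_num at h
    · exact hd3 (p3.dvd_of_dvd_pow h)
  have hzΔ : ¬ (3 : ℤ) ∣ -d ^ 6 := fun h => hd3 (p3.dvd_of_dvd_pow (dvd_neg.mp h))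
  have e4 : ((⟨0, 0, 1, -30, 63⟩ : WeierstrassCurve ℚ).quadraticTwist (d : ℚ)).c₄ =
      (3 : ℚ) ^ 2 * ((160 * d ^ 2 : ℤ) : ℚ) := by
    rw [quadraticTwist_c₄, c₄_curve27a4]; push_cast; ring
  have e6 : ((⟨0, 0, 1, -30, 63⟩ : WeierstrassCurve ℚ).quadraticTwist (d : ℚ)).c₆ =
      (3 : ℚ) ^ 3 * ((-2024 * d ^ 3 : ℤ) : ℚ) := by
    rw [quadraticTwist_c₆, c₆_curve27a4]; push_cast; ring
  have eΔ : ((⟨0, 0, 1, -30, 63⟩ : WeierstrassCurve ℚ).quadraticTwist (d : ℚ)).Δ =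
      (3 : ℚ) ^ 5 * ((-d ^ 6 : ℤ) : ℚ) := by
    rw [quadraticTwist_Δ, Δ_curve27a4]; push_cast; ring
  rw [tableKodairaSymbolThree, kodairaOfInvariants_eq_of_shift_zero (a := ((2 : ℤ) : WithTop ℤ))
    (b := ((3 : ℤ) : WithTop ℤ)) (c := 5) (k := 0)
    (by rw [e4, val3_pow_mul_intCast (mul_ne_zero (by norm_num) (pow_ne_zero _ hd0)) hz4]; simp)
    (by rw [e6, val3_pow_mul_intCast (mul_ne_zero (by norm_num) (pow_ne_zero _ hd0)) hz6]; simp)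
    (by rw [eΔ, padicValRat_three_pow_mul_intCast (neg_ne_zero.mpr (pow_ne_zero _ hd0)) hzΔ]; norm_num)
    (by decide)]
  exact kodaira_row_2_3_5 _ _ _

/-- **Table II on `27a4^{(3d₁)}`, `3 ∤ d₁`: valuations `(4, 6, 11)`, row `(4,6,11)`: Kodaira `II*`.**
(`c₄ = 3⁴·160d₁²`, `c₆ = 3⁶·(−2024d₁³)`, `Δ = 3¹¹·(−d₁⁶)`.) [cite: Rizzo2003, Table II (p. 4), row (4,6,11)]
[cite: Papadopoulos1993, Table III (p = 3)] -/
theorem tableKodairaSymbolThree_twist_of_dvd {d₁ : ℤ} (hd0 : d₁ ≠ 0) (hd3 : ¬ (3 : ℤ) ∣ d₁) :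
    ((⟨0, 0, 1, -30, 63⟩ : WeierstrassCurve ℚ).quadraticTwist ((3 * d₁ : ℤ) : ℚ)).tableKodairaSymbolThree =
      .IIstar := by
  have p3 : Prime (3 : ℤ) := Int.prime_three
  have hz4 : ¬ (3 : ℤ) ∣ 160 * d₁ ^ 2 := fun h => by
    rcases p3.dvd_or_dvd h with h | h
    · norm_num at h
    · exact hd3 (p3.dvd_of_dvd_pow h)
  have hz6 : ¬ (3 : ℤ) ∣ -2024 * d₁ ^ 3 := fun h => by
    rcases p3.dvd_or_dvd h with h | h
    · norm_num at h
    · exact hd3 (p3.dvd_of_dvd_pow h)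
  have hzΔ : ¬ (3 : ℤ) ∣ -d₁ ^ 6 := fun h => hd3 (p3.dvd_of_dvd_pow (dvd_neg.mp h))
  have e4 : ((⟨0, 0, 1, -30, 63⟩ : WeierstrassCurve ℚ).quadraticTwist ((3 * d₁ : ℤ) : ℚ)).c₄ =
      (3 : ℚ) ^ 4 * ((160 * d₁ ^ 2 : ℤ) : ℚ) := by
    rw [quadraticTwist_c₄, c₄_curve27a4]; push_cast; ring
  have e6 : ((⟨0, 0, 1, -30, 63⟩ : WeierstrassCurve ℚ).quadraticTwist ((3 * d₁ : ℤ) : ℚ)).c₆ =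
      (3 : ℚ) ^ 6 * ((-2024 * d₁ ^ 3 : ℤ) : ℚ) := by
    rw [quadraticTwist_c₆, c₆_curve27a4]; push_cast; ring
  have eΔ : ((⟨0, 0, 1, -30, 63⟩ : WeierstrassCurve ℚ).quadraticTwist ((3 * d₁ : ℤ) : ℚ)).Δ =
      (3 : ℚ) ^ 11 * ((-d₁ ^ 6 : ℤ) : ℚ) := by
    rw [quadraticTwist_Δ, Δ_curve27a4]; push_cast; ring
  rw [tableKodairaSymbolThree, kodairaOfInvariants_eq_of_shift_zero (a := ((4 : ℤ) : WithTop ℤ))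
    (b := ((6 : ℤ) : WithTop ℤ)) (c := 11) (k := 0)
    (by rw [e4, val3_pow_mul_intCast (mul_ne_zero (by norm_num) (pow_ne_zero _ hd0)) hz4]; simp)
    (by rw [e6, val3_pow_mul_intCast (mul_ne_zero (by norm_num) (pow_ne_zero _ hd0)) hz6]; simp)
    (by rw [eΔ, padicValRat_three_pow_mul_intCast (neg_ne_zero.mpr (pow_ne_zero _ hd0)) hzΔ]; norm_num)
    (by decide)]
  exact kodaira_row_4_6_11 _ _ _

/-- **Every model of `27a4^{(d)}` (`d ≠ 0` square-free) is of type IV or II* at `3`**, hence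
`c₃ ∈ {1, 3}` is ODD. [cite: Rizzo2003, Table II (p. 4), rows (2,3,5), (4,6,11)]
[cite: SilvermanATAEC1994, IV.9.4 Steps 5, 10 and Table 4.1] -/
theorem odd_localTamagawaNumber_three_twist (hd0 : d ≠ 0) (hsq : Squarefree d)
    (hC : C • W' = (⟨0, 0, 1, -30, 63⟩ : WeierstrassCurve ℚ).quadraticTwist (d : ℚ))
    (hv : natGenerator v = 3) :
    Odd ((W'.baseChange (v.adicCompletion ℚ)).localTamagawaNumber (v.adicCompletionIntegers ℚ)) := by
  haveI : PerfectField (IsLocalRing.ResidueField (v.adicCompletionIntegers ℚ)) := PerfectField.ofFinite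
  haveI := isElliptic_curve27a4
  have hdq : (d : ℚ) ≠ 0 := by exact_mod_cast hd0
  haveI := (⟨0, 0, 1, -30, 63⟩ : WeierstrassCurve ℚ).isElliptic_quadraticTwist hdq
  have hK : W'.kodairaSymbolAt v =
      ((⟨0, 0, 1, -30, 63⟩ : WeierstrassCurve ℚ).quadraticTwist (d : ℚ)).tableKodairaSymbolThree := by
    rw [← kodairaSymbolAt_smul' v W' C, hC]
    exact kodairaSymbolAt_eq_tableKodairaSymbolThree_of_primesEquiv_eq v _ hv
  by_cases hd3 : (3 : ℤ) ∣ d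
  · obtain ⟨d₁, rfl⟩ := hd3
    have hd₁0 : d₁ ≠ 0 := by rintro rfl; exact hd0 (by ring)
    have hd₁3 : ¬ (3 : ℤ) ∣ d₁ := fun ⟨e, he⟩ => by
      have hunit : IsUnit (3 : ℤ) := hsq 3 ⟨e, by rw [he]; ring⟩
      rcases Int.isUnit_iff.mp hunit with h | h <;> omega
    rw [tableKodairaSymbolThree_twist_of_dvd hd₁0 hd₁3] at hK
    exact odd_localTamagawaNumber_of_kodairaSymbolAt_eq_IIstar W' v hK
  · rw [tableKodairaSymbolThree_twist_of_not_dvd hd0 hd3] at hK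
    exact odd_localTamagawaNumber_of_kodairaSymbolAt_eq_IV W' v hK

end Three

/-! ## §3 The Tamagawa binder on the twists of `27a4`: `Odd ∏ c_ℓ ⟺ d` silent -/

section Tamagawa

variable (W' : WeierstrassCurve ℚ) [W'.IsElliptic] {C : VariableChange ℚ} {d : ℤ}

/-- A square-free integer divisible by a prime `p` is `p` times an integer prime to `p`. [folklore] -/
theorem exists_eq_mul_not_dvd_of_squarefree (hsq : Squarefree d) {p : ℕ} (hp : p.Prime)
    (hpd : (p : ℤ) ∣ d) : ∃ d₁ : ℤ, d = p * d₁ ∧ ¬ (p : ℤ) ∣ d₁ := by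
  obtain ⟨d₁, rfl⟩ := hpd
  refine ⟨d₁, rfl, fun ⟨e, he⟩ => ?_⟩
  have hunit : IsUnit (p : ℤ) := hsq (p : ℤ) ⟨e, by rw [he]; ring⟩
  rcases Int.isUnit_iff.mp hunit with h | h
  · exact hp.one_lt.ne' (by exact_mod_cast h)
  · have : (0 : ℤ) ≤ (p : ℤ) := by exact_mod_cast p.zero_le
    omega

/-- **THE TAMAGAWA BINDER ON THE `j = −12288000` CLASS.** For `d ∈ ℤ ∖ {0}` square-free and EVERY
model `W'` of `27a4^{(d)}`: `Odd (∏_ℓ c_ℓ(W')) ⟺` for every prime `p ≥ 5` with `p ∣ d`, the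
`2`-division cubic `4x³ − 120x + 253` of `27a4` has NO root mod `p` (`d` silent). Boxer–Diao's proof
of Prop. 4.1 run in the kernel: `c₂ = 1`; `c₃ ∈ {1,3}` (IV / II*); `c_p = 1` at `p ∤ 3d`; at
`p ∣ d`, `p ≥ 5`: `I₀*`, `c_p = 1` without a root, even with one.
[cite: BoxerDiao2010, proof of Prop. 4.1 (pp. 1976–1977)] [cite: SilvermanATAEC1994, IV.9.4 Step 6 and Table 4.1]
[cite: Rizzo2003, Table II (p. 4)] -/
theorem odd_tamagawaProduct_twist_iff (hd0 : d ≠ 0) (hsq : Squarefree d)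
    (hC : C • W' = (⟨0, 0, 1, -30, 63⟩ : WeierstrassCurve ℚ).quadraticTwist (d : ℚ)) :
    Odd W'.tamagawaProduct ↔
      ∀ p : ℕ, p.Prime → 5 ≤ p → (p : ℤ) ∣ d → ∀ x : ZMod p, 4 * x ^ 3 - 120 * x + 253 ≠ 0 := by
  haveI := isElliptic_curve27a4
  haveI := isGloballyMinimal_curve27a4
  set M : WeierstrassCurve ℤ := integralModelInt (⟨0, 0, 1, -30, 63⟩ : WeierstrassCurve ℚ) with hMdef
  have hM : M = ⟨0, 0, 1, -30, 63⟩ := integralModelInt_curve27a4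
  have hM1 : M.a₁ = 0 := by rw [hM]
  have hM3 : M.a₃ = 1 := by rw [hM]
  have hMΔ : M.Δ = -243 := by rw [hM]; exact Δ_curve27a4_int
  have h1 : (⟨0, 0, 1, -30, 63⟩ : WeierstrassCurve ℚ).a₁ = 0 := rfl
  have h3 : (⟨0, 0, 1, -30, 63⟩ : WeierstrassCurve ℚ).a₃ = 1 := rfl
  set J : WeierstrassCurve ℤ := ⟨0, 4 * d * M.a₂, 0, 16 * d ^ 2 * M.a₄,
    16 * d ^ 3 * (4 * M.a₆ + 1)⟩ with hJ
  -- `c_p(W') = c_p(J)` at every prime, `c₂ = 1`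
  have key : ∀ (p : ℕ) [Fact p.Prime], (W'.baseChange ℚ_[p]).localTamagawaNumber ℤ_[p] =
      ((J.map (Int.castRingHom ℤ_[p])).baseChange ℚ_[p]).localTamagawaNumber ℤ_[p] :=
    fun p _ => localTamagawaNumber_padic_eq_twistIntModel _ h1 h3 hd0 W' C hC p
  have hd4 : ¬ (4 : ℤ) ∣ d := fun ⟨e, he⟩ => by
    have hunit : IsUnit (2 : ℤ) := hsq 2 ⟨e, by rw [he]; ring⟩
    rcases Int.isUnit_iff.mp hunit with h | h <;> omega
  have key2 : (W'.baseChange ℚ_[2]).localTamagawaNumber ℤ_[2] = 1 :=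
    localTamagawaNumber_two_eq_one _ h1 h3 hd0 W' C hC hd4
  -- `p ∤ Δ(M) = −3⁵` for `p ≠ 3`
  have hpΔ : ∀ p : ℕ, p.Prime → p ≠ 3 → ¬ (p : ℤ) ∣ M.Δ := fun p hp hp3 h => by
    rw [hMΔ, dvd_neg, show (243 : ℤ) = 3 ^ 5 by norm_num] at h
    have h3' : (p : ℤ) ∣ 3 := (Nat.prime_iff_prime_int.mp hp).dvd_of_dvd_pow h
    exact hp3 ((Nat.prime_dvd_prime_iff_eq hp Nat.prime_three).mp (by exact_mod_cast h3'))
  -- the cubic of the integer twist model is `27a4`'s `2`-division cubic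
  have hcub : ∀ (p : ℕ) (x : ZMod p), 4 * x ^ 3 + 4 * (M.a₂ : ZMod p) * x ^ 2 +
      4 * (M.a₄ : ZMod p) * x + (4 * (M.a₆ : ZMod p) + 1) = 4 * x ^ 3 - 120 * x + 253 := by
    intro p x
    rw [hM]; push_cast; ring
  rw [odd_tamagawaProduct_iff W']
  constructor
  · -- an odd product forces silence at every `p ≥ 5` dividing `d`
    intro hodd p hp hp5 hpd x hx
    haveI : Fact p.Prime := ⟨hp⟩
    obtain ⟨v, hv⟩ := Mordell.exists_place_natGenerator_eq hp
    obtain ⟨d₁, hd₁, hpd₁⟩ := exists_eq_mul_not_dvd_of_squarefree hsq hp hpd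
    have h2c : 2 ∣ (W'.baseChange (v.adicCompletion ℚ)).localTamagawaNumber
        (v.adicCompletionIntegers ℚ) := by
      rw [← WeierstrassCurve.localTamagawaNumber_padic_eq_holds W' v p hv, key p]
      exact two_dvd_localTamagawaNumber_twistIntModel_of_dvd_of_root p M hM1 hM3 d J hJ hd₁
        (by omega) hpd₁ (hpΔ p hp (by omega)) ⟨x, by rw [hcub]; exact hx⟩
    exact (Nat.not_even_iff_odd.mpr (hodd v)) (even_iff_two_dvd.mpr h2c)
  · -- silence makes every local factor odd
    intro hsil v
    rcases natGenerator_cases v with hv | hv | hv5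
    · haveI : Fact (Nat.Prime 2) := ⟨Nat.prime_two⟩
      rw [← WeierstrassCurve.localTamagawaNumber_padic_eq_holds W' v 2 hv, key2]
      exact odd_one
    · exact odd_localTamagawaNumber_three_twist W' v hd0 hsq hC hv
    · haveI : Fact (Nat.Prime (natGenerator v)) := ⟨prime_natGenerator v⟩
      have hp2 : natGenerator v ≠ 2 := by omega
      have hp3 : natGenerator v ≠ 3 := by omega
      rw [← WeierstrassCurve.localTamagawaNumber_padic_eq_holds W' v (natGenerator v) rfl,
        key (natGenerator v)]
      by_cases hpd : (natGenerator v : ℤ) ∣ d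
      · obtain ⟨d₁, hd₁, hpd₁⟩ :=
          exists_eq_mul_not_dvd_of_squarefree hsq (prime_natGenerator v) hpd
        rw [localTamagawaNumber_twistIntModel_eq_one_of_dvd_of_no_root (natGenerator v) M hM1 hM3 d
          J hJ hd₁ hp2 hpd₁ (hpΔ _ (prime_natGenerator v) hp3) fun x hx => ?_]
        · exact odd_one
        exact hsil _ (prime_natGenerator v) hv5 hpd x (by rw [← hcub]; exact hx)
      · rw [localTamagawaNumber_twistIntModel_eq_one_of_not_dvd (natGenerator v) M hM1 hM3 d J hJ
          hp2 hpd (hpΔ _ (prime_natGenerator v) hp3)]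
        exact odd_one

end Tamagawa

/-! ## §4 CM, inertness, image; the arithmetic habitat on the `j = −12288000` class -/

section Habitat

variable (W' : WeierstrassCurve ℚ) [W'.IsElliptic] {C : VariableChange ℚ} {d : ℤ}

/-- Every model of a twist of `27a4` has `j = −12288000`. [cite: SilvermanATAEC1994, App. A §3 (row D = −27)] -/
theorem j_twist (hd0 : d ≠ 0)
    (hC : C • W' = (⟨0, 0, 1, -30, 63⟩ : WeierstrassCurve ℚ).quadraticTwist (d : ℚ)) :
    W'.j = -12288000 := by
  haveI := isElliptic_curve27a4
  have hdq : (d : ℚ) ≠ 0 := by exact_mod_cast hd0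
  have h := CornerFTwo.Atlas.j_eq_of_smul_twist (W := W') (E := ⟨0, 0, 1, -30, 63⟩) hdq
    (C := C⁻¹) (by rw [← hC, inv_smul_smul])
  rw [h, j_curve27a4]

/-- **Every model of `27a4^{(d)}` has CM (order of conductor `3` in `ℚ(√−3)`) with `2` INERT.**
[cite: Cox2013, §5.B Prop. 5.16 and Cor. 5.17] -/
theorem hasCM_and_cmInert_two_twist (hd0 : d ≠ 0)
    (hC : C • W' = (⟨0, 0, 1, -30, 63⟩ : WeierstrassCurve ℚ).quadraticTwist (d : ℚ)) :
    W'.HasCM ∧ CMInert W' 2 :=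
  CornerFTwo.hasCM_and_cmInert_two_of_j (Or.inr (Or.inl (j_twist W' hd0 hC)))

/-- **Every model of `27a4^{(d)}` has `ρ̄_{E,2}` onto `GL₂(𝔽₂)`** (`2` inert, `j ≠ 0, 54000`).
[cite: DokchitserDokchitserMathZ2012, Theorem (1)] [cite: SilvermanAEC2009, App. A §3] -/
theorem hasSurjectiveModNGaloisRep_two_twist (hd0 : d ≠ 0)
    (hC : C • W' = (⟨0, 0, 1, -30, 63⟩ : WeierstrassCurve ℚ).quadraticTwist (d : ℚ)) :
    W'.HasSurjectiveModNGaloisRep 2 := by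
  obtain ⟨hCM, hin⟩ := hasCM_and_cmInert_two_twist W' hd0 hC
  have hj := j_twist W' hd0 hC
  exact (hasSurjectiveModNGaloisRep_two_iff_of_cmInert_two_of_j_ne_zero W' hCM hin
    (by rw [hj]; norm_num)).mpr (by rw [hj]; norm_num)

/-- **THE ARITHMETIC BINDERS OF `H₂` ON THE `j = −12288000` CLASS, DECIDED.** For `d ≠ 0` square-free
and EVERY model `W'` of `27a4^{(d)}`:
`(W'.HasCM ∧ CMInert W' 2 ∧ ρ̄₂ onto ∧ Odd ∏ c_ℓ) ⟺ d` is silent (no root of `4x³ − 120x + 253`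
mod any prime `p ≥ 5` dividing `d`). [cite: BoxerDiao2010, proof of Prop. 4.1 (pp. 1976–1977)]
[cite: DokchitserDokchitserMathZ2012, Theorem (1)] [cite: Cox2013, §5.B] -/
theorem arithmeticHabitat_twist_iff (hd0 : d ≠ 0) (hsq : Squarefree d)
    (hC : C • W' = (⟨0, 0, 1, -30, 63⟩ : WeierstrassCurve ℚ).quadraticTwist (d : ℚ)) :
    (W'.HasCM ∧ CMInert W' 2 ∧ W'.HasSurjectiveModNGaloisRep 2 ∧ Odd W'.tamagawaProduct) ↔
      ∀ p : ℕ, p.Prime → 5 ≤ p → (p : ℤ) ∣ d → ∀ x : ZMod p, 4 * x ^ 3 - 120 * x + 253 ≠ 0 := by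
  obtain ⟨hCM, hin⟩ := hasCM_and_cmInert_two_twist W' hd0 hC
  rw [← odd_tamagawaProduct_twist_iff W' hd0 hsq hC]
  exact ⟨fun h => h.2.2.2, fun h => ⟨hCM, hin, hasSurjectiveModNGaloisRep_two_twist W' hd0 hC, h⟩⟩

/-- **A non-silent `d` puts every model of `27a4^{(d)}` in the residual** (item 22838): some `c_p`,
`p ∣ d`, is even. [cite: BoxerDiao2010, proof of Prop. 4.1 (p. 1977)] -/
theorem not_arithmeticHabitat_twist_of_root (hd0 : d ≠ 0) (hsq : Squarefree d)
    (hC : C • W' = (⟨0, 0, 1, -30, 63⟩ : WeierstrassCurve ℚ).quadraticTwist (d : ℚ))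
    {p : ℕ} (hp : p.Prime) (hp5 : 5 ≤ p) (hpd : (p : ℤ) ∣ d)
    (hx : ∃ x : ZMod p, 4 * x ^ 3 - 120 * x + 253 = 0) {P Q R : Prop} :
    ¬ (P ∧ Q ∧ Odd W'.tamagawaProduct ∧ R) := fun h => by
  obtain ⟨x, hx⟩ := hx
  exact (odd_tamagawaProduct_twist_iff W' hd0 hsq hC).mp h.2.2.1 p hp hp5 hpd x hx

end Habitat

end Summit.BirchSwinnertonDyer.Rank1Residual.P2.TwentySevenA4

end
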